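import Mathlib
import HarnessLib
import Summits.HubbardSuperconductivity.HubbardSuperconductivity.Theorems.KLProgrammeKLRegimeEngineTwoLegSpLegStepSplitScaleZero
import Summits.HubbardSuperconductivity.HubbardSuperconductivity.Theorems.KLProgrammeKLRegimeTwoVolumeGeometricRates
import Summits.HubbardSuperconductivity.HubbardSuperconductivity.Theorems.KLProgrammeKLRegimeTwoVolumeDualReadoutRows
import Summits.HubbardSuperconductivity.HubbardSuperconductivity.Theorems.KLProgrammeKLRegimeEngineV8TwoLegMomentsExportGrid

/-!
# Row C2 (`hsp`) of stub (e) at every scale, (R) KEYED TO THE GRID ATOM of token #23 — the maximal geometric packaging `a m = d·4^m`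
# (cell gate-hubbard-kl, seat hubbard-kl-r2d-p1 g8; GRID twin of k3c5-p2's `…EngineTwoLegSpLegDualDataFour`, p552526)

WHY.  Plan g19 (R59o) (KL STATUS 2026-08-27) made the GRID two-leg moments atom `TwoLegGridMomentsAt` / `TwoLegGridFlowMomentsAt`
(`…EngineV8TwoLegMomentsExportGrid`, p557865) THE text of record of the (b) → (e) two-leg export (token #23), retiring the dual-lattice atom: the
trivial-multiplier DUAL kernel of the cumulative one-shot action carries the `2M`-frequency Dirichlet tail at every scale (F-GRID), so no tower supplies
`hMs`-type dual moments.  k3c5-p2's row-C2 packagings `spLeg_allScales_of_dualMoments_V17F2_geometric4[_of_stepZero]` read their (R) half — the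
shell-tube gradient of the COARSE volume's separated reading at scale `n` — from such a dual moment `Ms n`.  This file is the twin with (R) read from the
GRID atom of the coarse volume `(L₁, M₂)` at its own flow frame (`twoLeg_slopeSizes_of_twoLegGridMomentsAt`: `‖∇ I_{L₁}[Re Σ − K∘p]‖ ≤ Zs·U²` at every `q`),
with n-FREE budgets `(Zt, Zs)` as in the text of record; the (D) half (`hdual`: the phase-weighted time sums at `±ω₀` = the `±ω₀` frequency slice, hence
representation-free) and the budget algebra on the rates `d·4^m` are VERBATIM k3c5-p2's:

* **`spLeg_allScales_of_gridMoments_V17F2_geometric4`** — the literal `hsp` of the (e)/(M) closers at every `n ≤ N ≤ nScales β + 1` from `hGs` (grid atoms of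
  the coarse comparison volumes, smallness `Zs·U² + 4/3·Gfr₁U² ≤ klCurveD`) and the dual defect data with `Dd n + Df n ≤ d·4^n/3`;
* **`spLeg_allScales_of_gridMoments_V17F2_geometric4_of_stepZero`** — the same with the SCALE-0 STEP supplied separately and the data only for `1 ≤ n ≤ N`.

Proofs only (k3c5-p2's two proofs with the (R) line swapped); no definitions; nothing about the model is asserted; nothing asserts superconductivity.
References: BGM 2006 §2.4 (2.23), (2.36) [cite: BenfattoGiulianiMastropietro2006].
-/

noncomputable section

namespace Summit.HubbardSuperconductivity.HubbardSuperconductivity.Theorems.EngineV8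

set_option linter.dupNamespace false -- summit = problem name (single-conjunct summit), D-0017

open Real Finset Complex Literature.MathematicalPhysics.QuantumLattice Literature.Probability.LatticeModels GrassmannAlgebra
open Summit.HubbardSuperconductivity.HubbardSuperconductivity.Theorems.KLProgrammeLegKernels
open Summit.HubbardSuperconductivity.HubbardSuperconductivity.Theorems.DispersionFlow
open Summit.HubbardSuperconductivity.HubbardSuperconductivity.Theorems.PerturbedFermiCurve
open Summit.HubbardSuperconductivity.HubbardSuperconductivity.Theorems.KLRegimeSplit
open Summit.HubbardSuperconductivity.HubbardSuperconductivity.Theorems.TwoPointAssembly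
open Summit.HubbardSuperconductivity.HubbardSuperconductivity.Theorems.TwoVolumeDefect
open Summit.HubbardSuperconductivity.HubbardSuperconductivity.Theorems.TwoLegFourier

section V17F2

variable {L : ℕ} {G : GeoConsts} {P : SplitConsts} {Q : EngConsts} {R : RenConsts} {β U μ c : ℝ}

/-- **ROW C2 (`hsp`) AT EVERY SCALE ON THE MAXIMAL GEOMETRIC RATES `d·4^n`, (R) KEYED TO THE GRID ATOM** (twin of k3c5-p2's
`spLeg_allScales_of_dualMoments_V17F2_geometric4`): with `0 ≤ d ≤ Q.CL β 0/4`, `Q.CL β 0·4^n ≤ Q.CL β n`, n-FREE grid budgets `(Zt, Zs)` with `0 ≤ Zs` and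
the smallness `Zs·U² + 4/3·Gfr₁U² ≤ klCurveD`, per scale the grid atom `TwoLegGridMomentsAt L₁ M₂ Zt Zs β U μ (K_n(L₁,M₂)) n` of the COARSE volume (the text of
record of token #23, (R59o)) and the dual defect data with `Dd n + Df n ≤ d·4^n/3`: the literal `hsp` of the (e)/(M) closers at every `n ≤ N ≤ nScales β + 1`. -/
theorem spLeg_allScales_of_gridMoments_V17F2_geometric4 (hR : ∀ j, 0 ≤ R.Gfr j) (hc : 0 < c) (hcle : c ≤ klCurveC3 R) (hU : 0 < U)
    (hUle : U ≤ klCurveU0 R) (hβmin : klBetaMin ≤ β) (hβc : β ≤ Real.exp (c / U ^ 2)) (hμ : μ ∈ klWindowC) (hL : klEngL₃ β U ≤ L)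
    (h0 : FrameOK R U (nScales β) μ 0) {N : ℕ} (hN : N ≤ nScales β + 1) {d : ℝ} (hd : 0 ≤ d) (hdCL : d ≤ Q.CL β 0 / 4)
    (hCL : ∀ n ≤ N, Q.CL β 0 * (4 : ℝ) ^ n ≤ Q.CL β n) {Zt Zs : ℝ} {Dd Df : ℕ → ℝ} (hZs0 : 0 ≤ Zs)
    (hsmall : Zs * U ^ 2 + 4 / 3 * R.Gfr 1 * U ^ 2 ≤ klCurveD) (hDsum : ∀ n ≤ N, Dd n + Df n ≤ d * (4 : ℝ) ^ n / 3)
    (hGs : ∀ n ≤ N, ∀ (Mq : ℕ → ℕ) (L₁ L₂ M₂ : ℕ) [NeZero L₁] [NeZero L₂] [NeZero M₂], L ≤ L₁ → L₁ ∣ L₂ → Q.M0 β L₁ ≤ M₂ →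
      Mq L₁ ≤ M₂ → Q.M0 β L₂ ≤ M₂ → Mq L₂ ≤ M₂ →
      (∀ j < n, histV17F2 L₁ M₂ G P Q R β U μ j ∧ TwoLegSlopes L₁ M₂ R β U μ (klFlowFrameU L₁ M₂ β U μ j) j) →
      (∀ j < n, histV17F2 L₂ M₂ G P Q R β U μ j ∧ TwoLegSlopes L₂ M₂ R β U μ (klFlowFrameU L₂ M₂ β U μ j) j) →
      (∀ m < n, ∀ θ : ℝ, |klLocalPart L₁ M₂ β U μ (klFlowFrameU L₁ M₂ β U μ m) m θ -
        klLocalPart L₂ M₂ β U μ (klFlowFrameU L₂ M₂ β U μ m) m θ| ≤ d * (4 : ℝ) ^ m / L₁) →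
      (∀ q : Fin 2 → ℝ, |(klFlowFrameU L₁ M₂ β U μ n).eval q - (klFlowFrameU L₂ M₂ β U μ n).eval q| ≤
        (∑ m ∈ range n, d * (4 : ℝ) ^ m) / L₁) →
        TwoLegGridMomentsAt L₁ M₂ Zt Zs β U μ (klFlowFrameU L₁ M₂ β U μ n) n)
    (hdual : ∀ n ≤ N, ∀ (Mq : ℕ → ℕ) (L₁ L₂ M₂ : ℕ) [NeZero L₁] [NeZero L₂] [NeZero M₂], L ≤ L₁ → L₁ ∣ L₂ → Q.M0 β L₁ ≤ M₂ →
      Mq L₁ ≤ M₂ → Q.M0 β L₂ ≤ M₂ → Mq L₂ ≤ M₂ →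
      (∀ j < n, histV17F2 L₁ M₂ G P Q R β U μ j ∧ TwoLegSlopes L₁ M₂ R β U μ (klFlowFrameU L₁ M₂ β U μ j) j) →
      (∀ j < n, histV17F2 L₂ M₂ G P Q R β U μ j ∧ TwoLegSlopes L₂ M₂ R β U μ (klFlowFrameU L₂ M₂ β U μ j) j) →
      (∀ m < n, ∀ θ : ℝ, |klLocalPart L₁ M₂ β U μ (klFlowFrameU L₁ M₂ β U μ m) m θ -
        klLocalPart L₂ M₂ β U μ (klFlowFrameU L₂ M₂ β U μ m) m θ| ≤ d * (4 : ℝ) ^ m / L₁) →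
      (∀ q : Fin 2 → ℝ, |(klFlowFrameU L₁ M₂ β U μ n).eval q - (klFlowFrameU L₂ M₂ β U μ n).eval q| ≤
        (∑ m ∈ range n, d * (4 : ℝ) ^ m) / L₁) →
      ∃ (oc : SpaceTimeIdx L₁ M₂) (of : SpaceTimeIdx L₂ M₂),
        (∀ m ∈ ({omega0 M₂, (omega0 M₂).rev} : Finset (MatsubaraIdx M₂)), ∀ σ : Fin 2, imagTimeWeight β M₂ * ∑ ybar : TorusSite 2 L₁,
          (‖(∑ t₁ : ImagTimeIdx M₂,
              sectorisedKernel L₁ M₂ β (trivialMultiplier L₁ M₂)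
                  (klEffectiveAction L₁ M₂ β U μ (klFlowFrameU L₁ M₂ β U μ n) klE0 n - counterQuadratic L₁ M₂ β (klFlowFrameU L₁ M₂ β U μ n)) 2
                  (![((0, σ), 0), ((0, σ), 1)] : Fin 2 → SectorLeg 1) ![oc, (t₁, oc.2 + ybar)] *
                Complex.exp (((matsubaraFreq β M₂ m * (imagTime β M₂ oc.1 - imagTime β M₂ t₁) : ℝ) : ℂ) * I)) -
            (∑ t₁ : ImagTimeIdx M₂,
              sectorisedKernel L₂ M₂ β (trivialMultiplier L₂ M₂)
                  (klEffectiveAction L₂ M₂ β U μ (klFlowFrameU L₂ M₂ β U μ n) klE0 n - counterQuadratic L₂ M₂ β (klFlowFrameU L₂ M₂ β U μ n)) 2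
                  (![((0, σ), 0), ((0, σ), 1)] : Fin 2 → SectorLeg 1) ![of, (t₁, of.2 + Torus.proj L₂ (Torus.cRep ybar))] *
                Complex.exp (((matsubaraFreq β M₂ m * (imagTime β M₂ of.1 - imagTime β M₂ t₁) : ℝ) : ℂ) * I))‖ +
          ‖(∑ t₁ : ImagTimeIdx M₂,
              sectorisedKernel L₁ M₂ β (trivialMultiplier L₁ M₂)
                  (klEffectiveAction L₁ M₂ β U μ (klFlowFrameU L₁ M₂ β U μ n) klE0 n - counterQuadratic L₁ M₂ β (klFlowFrameU L₁ M₂ β U μ n)) 2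
                  (![((0, σ), 0), ((0, σ), 1)] : Fin 2 → SectorLeg 1) ![oc, (t₁, oc.2 + -ybar)] *
                Complex.exp (((matsubaraFreq β M₂ m * (imagTime β M₂ oc.1 - imagTime β M₂ t₁) : ℝ) : ℂ) * I)) -
            (∑ t₁ : ImagTimeIdx M₂,
              sectorisedKernel L₂ M₂ β (trivialMultiplier L₂ M₂)
                  (klEffectiveAction L₂ M₂ β U μ (klFlowFrameU L₂ M₂ β U μ n) klE0 n - counterQuadratic L₂ M₂ β (klFlowFrameU L₂ M₂ β U μ n)) 2
                  (![((0, σ), 0), ((0, σ), 1)] : Fin 2 → SectorLeg 1) ![of, (t₁, of.2 + -Torus.proj L₂ (Torus.cRep ybar))] *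
                Complex.exp (((matsubaraFreq β M₂ m * (imagTime β M₂ of.1 - imagTime β M₂ t₁) : ℝ) : ℂ) * I))‖) ≤ Dd n / L₁) ∧
        (∀ m ∈ ({omega0 M₂, (omega0 M₂).rev} : Finset (MatsubaraIdx M₂)), ∀ σ : Fin 2, imagTimeWeight β M₂ *
          ∑ y ∈ univ.filter (fun y : TorusSite 2 L₂ => Torus.proj L₂ (Torus.cRep (fun i => (((y i).val : ℕ) : ZMod L₁))) ≠ y),
          (‖(∑ t₁ : ImagTimeIdx M₂,
              sectorisedKernel L₂ M₂ β (trivialMultiplier L₂ M₂)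
                  (klEffectiveAction L₂ M₂ β U μ (klFlowFrameU L₂ M₂ β U μ n) klE0 n - counterQuadratic L₂ M₂ β (klFlowFrameU L₂ M₂ β U μ n)) 2
                  (![((0, σ), 0), ((0, σ), 1)] : Fin 2 → SectorLeg 1) ![of, (t₁, of.2 + y)] *
                Complex.exp (((matsubaraFreq β M₂ m * (imagTime β M₂ of.1 - imagTime β M₂ t₁) : ℝ) : ℂ) * I))‖ +
          ‖(∑ t₁ : ImagTimeIdx M₂,
              sectorisedKernel L₂ M₂ β (trivialMultiplier L₂ M₂)
                  (klEffectiveAction L₂ M₂ β U μ (klFlowFrameU L₂ M₂ β U μ n) klE0 n - counterQuadratic L₂ M₂ β (klFlowFrameU L₂ M₂ β U μ n)) 2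
                  (![((0, σ), 0), ((0, σ), 1)] : Fin 2 → SectorLeg 1) ![of, (t₁, of.2 + -y)] *
                Complex.exp (((matsubaraFreq β M₂ m * (imagTime β M₂ of.1 - imagTime β M₂ t₁) : ℝ) : ℂ) * I))‖) ≤ Df n / L₁)) :
    ∀ n ≤ N, ∀ (Mq : ℕ → ℕ) (L₁ L₂ M₂ : ℕ) [NeZero L₁] [NeZero L₂] [NeZero M₂], L ≤ L₁ → L₁ ∣ L₂ → Q.M0 β L₁ ≤ M₂ → Mq L₁ ≤ M₂ →
      Q.M0 β L₂ ≤ M₂ → Mq L₂ ≤ M₂ →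
      (∀ j < n, histV17F2 L₁ M₂ G P Q R β U μ j ∧ TwoLegSlopes L₁ M₂ R β U μ (klFlowFrameU L₁ M₂ β U μ j) j) →
      (∀ j < n, histV17F2 L₂ M₂ G P Q R β U μ j ∧ TwoLegSlopes L₂ M₂ R β U μ (klFlowFrameU L₂ M₂ β U μ j) j) →
        ∀ θ : ℝ, |klLocalPart L₁ M₂ β U μ (klFlowFrameU L₁ M₂ β U μ n) n θ -
          klLocalPart L₂ M₂ β U μ (klFlowFrameU L₂ M₂ β U μ n) n θ| ≤ Q.CL β n / 4 / L₁ := by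
  have hβ0 : 0 < β := lt_of_lt_of_le (by norm_num [klBetaMin]) hβmin
  have hDpos : 0 < klCurveD := by unfold klCurveD; linarith [cDtmin_window_ge]
  refine spLeg_allScales_of_pointDefects_V17F2_rates (G := G) (P := P) (a := fun m => d * (4 : ℝ) ^ m)
    (b := fun _ => Zs * U ^ 2 + 4 / 3 * R.Gfr 1 * U ^ 2) (d := fun n => (∑ m ∈ range n, d * (4 : ℝ) ^ m) + Dd n + Df n)
    hR hc hcle hU hUle hβmin hβc hμ h0 hN (fun n hn => ?_) (fun n hn => by have := hZs0; have := hR 1; positivity) ?_ ?_ (fun n hn => ?_)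
  · -- closure to the public ceiling
    calc d * (4 : ℝ) ^ n ≤ Q.CL β 0 / 4 * (4 : ℝ) ^ n := mul_le_mul_of_nonneg_right hdCL (by positivity)
      _ = Q.CL β 0 * (4 : ℝ) ^ n / 4 := by ring
      _ ≤ Q.CL β n / 4 := div_le_div_of_nonneg_right (hCL n hn) (by norm_num)
  · -- (R) from the GRID atom of the coarse volume
    intro n hn Mq L₁ L₂ M₂ _ _ _ hLL₁ hdvd hM₁ hMq₁ hM₂ hMq₂ hh₁ hh₂ hrates hframe q _
    have hK₁ := frameOK_klFlowFrameU_of_histV17F2 (L' := L₁) (M' := M₂) hR h0 (hn.trans hN) hh₁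
    have hdeg₁ : (klFlowFrameU L₁ M₂ β U μ n).degree ≤ L₁ / 2 :=
      (frameOKDeg_klFlowFrameU hK₁ (hn.trans hN)).degree_le_half rfl hβmin (hL.trans hLL₁)
    have hsep := (twoLeg_slopeSizes_of_twoLegGridMomentsAt (L := L₁) (M := M₂) hβ0
      (hGs n hn Mq L₁ L₂ M₂ hLL₁ hdvd hM₁ hMq₁ hM₂ hMq₂ hh₁ hh₂ hrates hframe)).2 q
    refine (norm_fderiv_evalM_symInterp_le_of_sep_at (L := L₁) (M := M₂) hdeg₁ β U μ n q hsep).trans ?_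
    linarith [norm_iteratedFDeriv_one_frameShift_le_of_frameOK hR hK₁ q]
  · -- (D) from the dual defect data
    intro n hn Mq L₁ L₂ M₂ _ _ _ hLL₁ hdvd hM₁ hMq₁ hM₂ hMq₂ hh₁ hh₂ hrates hframe θ
    obtain ⟨b', hb'⟩ := hdvd
    have hL' : L₂ = b' * L₁ := by rw [hb', mul_comm]
    have hLL₂ : L ≤ L₂ := hLL₁.trans (Nat.le_of_dvd (Nat.pos_of_ne_zero (NeZero.ne L₂)) ⟨b', hb'⟩)
    have hL₁0 : (0 : ℝ) < L₁ := by exact_mod_cast Nat.pos_of_ne_zero (NeZero.ne L₁)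
    have hε : 0 < imagTimeWeight β M₂ := by
      unfold imagTimeWeight
      have : (0 : ℝ) < M₂ := by exact_mod_cast Nat.pos_of_ne_zero (NeZero.ne M₂)
      positivity
    have hK₁ := frameOK_klFlowFrameU_of_histV17F2 (L' := L₁) (M' := M₂) hR h0 (hn.trans hN) hh₁
    have hK₂ := frameOK_klFlowFrameU_of_histV17F2 (L' := L₂) (M' := M₂) hR h0 (hn.trans hN) hh₂
    have hdeg₁ : (klFlowFrameU L₁ M₂ β U μ n).degree ≤ L₁ / 2 :=
      (frameOKDeg_klFlowFrameU hK₁ (hn.trans hN)).degree_le_half rfl hβmin (hL.trans hLL₁)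
    have hdeg₂ : (klFlowFrameU L₂ M₂ β U μ n).degree ≤ L₂ / 2 :=
      (frameOKDeg_klFlowFrameU hK₂ (hn.trans hN)).degree_le_half rfl hβmin (hL.trans hLL₂)
    obtain ⟨oc, of, hdef, hfar⟩ := hdual n hn Mq L₁ L₂ M₂ hLL₁ ⟨b', hb'⟩ hM₁ hMq₁ hM₂ hMq₂ hh₁ hh₂ hrates hframe
    have hdef' := fun m hm σ => (le_div_iff₀' hε).2 (hdef m hm σ)
    have hfar' := fun m hm σ => (le_div_iff₀' hε).2 (hfar m hm σ)
    have hD := abs_symInterp_locRe_sub_le_frame_add_dualDefect' (M := M₂) hL' hβ0 U μ hdeg₁ hdeg₂ n oc of hdef' hfar'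
      (klFermiPoint μ (klFlowFrameU L₂ M₂ β U μ n) θ)
    refine hD.trans ?_
    have hKq := hframe (klFermiPoint μ (klFlowFrameU L₂ M₂ β U μ n) θ)
    have hεsimp : imagTimeWeight β M₂ * (Dd n / L₁ / imagTimeWeight β M₂ + Df n / L₁ / imagTimeWeight β M₂) = (Dd n + Df n) / L₁ := by
      field_simp
    rw [hεsimp]
    have hsum : (∑ m ∈ range n, d * (4 : ℝ) ^ m) / L₁ + (Dd n + Df n) / L₁ = ((∑ m ∈ range n, d * (4 : ℝ) ^ m) + Dd n + Df n) / L₁ := by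
      field_simp
      ring
    linarith [hsum]
  · -- the budget on the rates `d·4^m`: `(b/klCurveD)·F + F + (Dd + Df) ≤ 2F + d·4^n/3 ≤ d·4^n`
    show (Zs * U ^ 2 + 4 / 3 * R.Gfr 1 * U ^ 2) * (∑ m ∈ range n, d * (4 : ℝ) ^ m) / klCurveD +
        ((∑ m ∈ range n, d * (4 : ℝ) ^ m) + Dd n + Df n) ≤ d * (4 : ℝ) ^ n
    rw [sum_range_mul_four_pow]
    have hF0 : 0 ≤ d * ((4 : ℝ) ^ n - 1) / 3 := by
      have : (1 : ℝ) ≤ (4 : ℝ) ^ n := one_le_pow₀ (by norm_num)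
      have : 0 ≤ d * ((4 : ℝ) ^ n - 1) := mul_nonneg hd (by linarith)
      linarith
    have h1 : (Zs * U ^ 2 + 4 / 3 * R.Gfr 1 * U ^ 2) * (d * ((4 : ℝ) ^ n - 1) / 3) / klCurveD ≤ d * ((4 : ℝ) ^ n - 1) / 3 := by
      rw [div_le_iff₀ hDpos]
      calc (Zs * U ^ 2 + 4 / 3 * R.Gfr 1 * U ^ 2) * (d * ((4 : ℝ) ^ n - 1) / 3)
          ≤ klCurveD * (d * ((4 : ℝ) ^ n - 1) / 3) := mul_le_mul_of_nonneg_right hsmall hF0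
        _ = d * ((4 : ℝ) ^ n - 1) / 3 * klCurveD := by ring
    have h2 := hDsum n hn
    have h3 : d * ((4 : ℝ) ^ n - 1) / 3 + (d * ((4 : ℝ) ^ n - 1) / 3 + Dd n + Df n) ≤ d * (4 : ℝ) ^ n := by nlinarith
    linarith

/-- **ROW C2 (`hsp`) AT EVERY SCALE ON THE RATES `d·4^n`, (R) KEYED TO THE GRID ATOM, THE SCALE-0 STEP GIVEN** (`hstep0 : |Δν₀| ≤ d/L₁`, e.g. p1b's
`abs_klLocalPart_flowFrame_zero_spLeg_le_inv` when `d ≥ 1`): the grid atoms `hGs`, the dual defect data `hdual` and the allowances are asked only for `1 ≤ n ≤ N`. -/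
theorem spLeg_allScales_of_gridMoments_V17F2_geometric4_of_stepZero (hR : ∀ j, 0 ≤ R.Gfr j) (hc : 0 < c) (hcle : c ≤ klCurveC3 R) (hU : 0 < U)
    (hUle : U ≤ klCurveU0 R) (hβmin : klBetaMin ≤ β) (hβc : β ≤ Real.exp (c / U ^ 2)) (hμ : μ ∈ klWindowC) (hL : klEngL₃ β U ≤ L)
    (h0 : FrameOK R U (nScales β) μ 0) {N : ℕ} (hN : N ≤ nScales β + 1) {d : ℝ} (hd : 0 ≤ d) (hdCL : d ≤ Q.CL β 0 / 4)
    (hCL : ∀ n ≤ N, Q.CL β 0 * (4 : ℝ) ^ n ≤ Q.CL β n) {Zt Zs : ℝ} {Dd Df : ℕ → ℝ} (hZs0 : 0 ≤ Zs)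
    (hsmall : Zs * U ^ 2 + 4 / 3 * R.Gfr 1 * U ^ 2 ≤ klCurveD) (hDsum : ∀ n, 1 ≤ n → n ≤ N → Dd n + Df n ≤ d * (4 : ℝ) ^ n / 3)
    (hstep0 : ∀ (Mq : ℕ → ℕ) (L₁ L₂ M₂ : ℕ) [NeZero L₁] [NeZero L₂] [NeZero M₂], L ≤ L₁ → L₁ ∣ L₂ → Q.M0 β L₁ ≤ M₂ → Mq L₁ ≤ M₂ →
      Q.M0 β L₂ ≤ M₂ → Mq L₂ ≤ M₂ →
        ∀ θ : ℝ, |klLocalPart L₁ M₂ β U μ (klFlowFrameU L₁ M₂ β U μ 0) 0 θ -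
          klLocalPart L₂ M₂ β U μ (klFlowFrameU L₂ M₂ β U μ 0) 0 θ| ≤ d / L₁)
    (hGs : ∀ n, 1 ≤ n → n ≤ N → ∀ (Mq : ℕ → ℕ) (L₁ L₂ M₂ : ℕ) [NeZero L₁] [NeZero L₂] [NeZero M₂], L ≤ L₁ → L₁ ∣ L₂ → Q.M0 β L₁ ≤ M₂ →
      Mq L₁ ≤ M₂ → Q.M0 β L₂ ≤ M₂ → Mq L₂ ≤ M₂ →
      (∀ j < n, histV17F2 L₁ M₂ G P Q R β U μ j ∧ TwoLegSlopes L₁ M₂ R β U μ (klFlowFrameU L₁ M₂ β U μ j) j) →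
      (∀ j < n, histV17F2 L₂ M₂ G P Q R β U μ j ∧ TwoLegSlopes L₂ M₂ R β U μ (klFlowFrameU L₂ M₂ β U μ j) j) →
      (∀ m < n, ∀ θ : ℝ, |klLocalPart L₁ M₂ β U μ (klFlowFrameU L₁ M₂ β U μ m) m θ -
        klLocalPart L₂ M₂ β U μ (klFlowFrameU L₂ M₂ β U μ m) m θ| ≤ d * (4 : ℝ) ^ m / L₁) →
      (∀ q : Fin 2 → ℝ, |(klFlowFrameU L₁ M₂ β U μ n).eval q - (klFlowFrameU L₂ M₂ β U μ n).eval q| ≤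
        (∑ m ∈ range n, d * (4 : ℝ) ^ m) / L₁) →
        TwoLegGridMomentsAt L₁ M₂ Zt Zs β U μ (klFlowFrameU L₁ M₂ β U μ n) n)
    (hdual : ∀ n, 1 ≤ n → n ≤ N → ∀ (Mq : ℕ → ℕ) (L₁ L₂ M₂ : ℕ) [NeZero L₁] [NeZero L₂] [NeZero M₂], L ≤ L₁ → L₁ ∣ L₂ → Q.M0 β L₁ ≤ M₂ →
      Mq L₁ ≤ M₂ → Q.M0 β L₂ ≤ M₂ → Mq L₂ ≤ M₂ →
      (∀ j < n, histV17F2 L₁ M₂ G P Q R β U μ j ∧ TwoLegSlopes L₁ M₂ R β U μ (klFlowFrameU L₁ M₂ β U μ j) j) →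
      (∀ j < n, histV17F2 L₂ M₂ G P Q R β U μ j ∧ TwoLegSlopes L₂ M₂ R β U μ (klFlowFrameU L₂ M₂ β U μ j) j) →
      (∀ m < n, ∀ θ : ℝ, |klLocalPart L₁ M₂ β U μ (klFlowFrameU L₁ M₂ β U μ m) m θ -
        klLocalPart L₂ M₂ β U μ (klFlowFrameU L₂ M₂ β U μ m) m θ| ≤ d * (4 : ℝ) ^ m / L₁) →
      (∀ q : Fin 2 → ℝ, |(klFlowFrameU L₁ M₂ β U μ n).eval q - (klFlowFrameU L₂ M₂ β U μ n).eval q| ≤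
        (∑ m ∈ range n, d * (4 : ℝ) ^ m) / L₁) →
      ∃ (oc : SpaceTimeIdx L₁ M₂) (of : SpaceTimeIdx L₂ M₂),
        (∀ m ∈ ({omega0 M₂, (omega0 M₂).rev} : Finset (MatsubaraIdx M₂)), ∀ σ : Fin 2, imagTimeWeight β M₂ * ∑ ybar : TorusSite 2 L₁,
          (‖(∑ t₁ : ImagTimeIdx M₂,
              sectorisedKernel L₁ M₂ β (trivialMultiplier L₁ M₂)
                  (klEffectiveAction L₁ M₂ β U μ (klFlowFrameU L₁ M₂ β U μ n) klE0 n - counterQuadratic L₁ M₂ β (klFlowFrameU L₁ M₂ β U μ n)) 2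
                  (![((0, σ), 0), ((0, σ), 1)] : Fin 2 → SectorLeg 1) ![oc, (t₁, oc.2 + ybar)] *
                Complex.exp (((matsubaraFreq β M₂ m * (imagTime β M₂ oc.1 - imagTime β M₂ t₁) : ℝ) : ℂ) * I)) -
            (∑ t₁ : ImagTimeIdx M₂,
              sectorisedKernel L₂ M₂ β (trivialMultiplier L₂ M₂)
                  (klEffectiveAction L₂ M₂ β U μ (klFlowFrameU L₂ M₂ β U μ n) klE0 n - counterQuadratic L₂ M₂ β (klFlowFrameU L₂ M₂ β U μ n)) 2
                  (![((0, σ), 0), ((0, σ), 1)] : Fin 2 → SectorLeg 1) ![of, (t₁, of.2 + Torus.proj L₂ (Torus.cRep ybar))] *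
                Complex.exp (((matsubaraFreq β M₂ m * (imagTime β M₂ of.1 - imagTime β M₂ t₁) : ℝ) : ℂ) * I))‖ +
          ‖(∑ t₁ : ImagTimeIdx M₂,
              sectorisedKernel L₁ M₂ β (trivialMultiplier L₁ M₂)
                  (klEffectiveAction L₁ M₂ β U μ (klFlowFrameU L₁ M₂ β U μ n) klE0 n - counterQuadratic L₁ M₂ β (klFlowFrameU L₁ M₂ β U μ n)) 2
                  (![((0, σ), 0), ((0, σ), 1)] : Fin 2 → SectorLeg 1) ![oc, (t₁, oc.2 + -ybar)] *
                Complex.exp (((matsubaraFreq β M₂ m * (imagTime β M₂ oc.1 - imagTime β M₂ t₁) : ℝ) : ℂ) * I)) -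
            (∑ t₁ : ImagTimeIdx M₂,
              sectorisedKernel L₂ M₂ β (trivialMultiplier L₂ M₂)
                  (klEffectiveAction L₂ M₂ β U μ (klFlowFrameU L₂ M₂ β U μ n) klE0 n - counterQuadratic L₂ M₂ β (klFlowFrameU L₂ M₂ β U μ n)) 2
                  (![((0, σ), 0), ((0, σ), 1)] : Fin 2 → SectorLeg 1) ![of, (t₁, of.2 + -Torus.proj L₂ (Torus.cRep ybar))] *
                Complex.exp (((matsubaraFreq β M₂ m * (imagTime β M₂ of.1 - imagTime β M₂ t₁) : ℝ) : ℂ) * I))‖) ≤ Dd n / L₁) ∧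
        (∀ m ∈ ({omega0 M₂, (omega0 M₂).rev} : Finset (MatsubaraIdx M₂)), ∀ σ : Fin 2, imagTimeWeight β M₂ *
          ∑ y ∈ univ.filter (fun y : TorusSite 2 L₂ => Torus.proj L₂ (Torus.cRep (fun i => (((y i).val : ℕ) : ZMod L₁))) ≠ y),
          (‖(∑ t₁ : ImagTimeIdx M₂,
              sectorisedKernel L₂ M₂ β (trivialMultiplier L₂ M₂)
                  (klEffectiveAction L₂ M₂ β U μ (klFlowFrameU L₂ M₂ β U μ n) klE0 n - counterQuadratic L₂ M₂ β (klFlowFrameU L₂ M₂ β U μ n)) 2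
                  (![((0, σ), 0), ((0, σ), 1)] : Fin 2 → SectorLeg 1) ![of, (t₁, of.2 + y)] *
                Complex.exp (((matsubaraFreq β M₂ m * (imagTime β M₂ of.1 - imagTime β M₂ t₁) : ℝ) : ℂ) * I))‖ +
          ‖(∑ t₁ : ImagTimeIdx M₂,
              sectorisedKernel L₂ M₂ β (trivialMultiplier L₂ M₂)
                  (klEffectiveAction L₂ M₂ β U μ (klFlowFrameU L₂ M₂ β U μ n) klE0 n - counterQuadratic L₂ M₂ β (klFlowFrameU L₂ M₂ β U μ n)) 2
                  (![((0, σ), 0), ((0, σ), 1)] : Fin 2 → SectorLeg 1) ![of, (t₁, of.2 + -y)] *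
                Complex.exp (((matsubaraFreq β M₂ m * (imagTime β M₂ of.1 - imagTime β M₂ t₁) : ℝ) : ℂ) * I))‖) ≤ Df n / L₁)) :
    ∀ n ≤ N, ∀ (Mq : ℕ → ℕ) (L₁ L₂ M₂ : ℕ) [NeZero L₁] [NeZero L₂] [NeZero M₂], L ≤ L₁ → L₁ ∣ L₂ → Q.M0 β L₁ ≤ M₂ → Mq L₁ ≤ M₂ →
      Q.M0 β L₂ ≤ M₂ → Mq L₂ ≤ M₂ →
      (∀ j < n, histV17F2 L₁ M₂ G P Q R β U μ j ∧ TwoLegSlopes L₁ M₂ R β U μ (klFlowFrameU L₁ M₂ β U μ j) j) →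
      (∀ j < n, histV17F2 L₂ M₂ G P Q R β U μ j ∧ TwoLegSlopes L₂ M₂ R β U μ (klFlowFrameU L₂ M₂ β U μ j) j) →
        ∀ θ : ℝ, |klLocalPart L₁ M₂ β U μ (klFlowFrameU L₁ M₂ β U μ n) n θ -
          klLocalPart L₂ M₂ β U μ (klFlowFrameU L₂ M₂ β U μ n) n θ| ≤ Q.CL β n / 4 / L₁ := by
  have hβ0 : 0 < β := lt_of_lt_of_le (by norm_num [klBetaMin]) hβmin
  have hDpos : 0 < klCurveD := by unfold klCurveD; linarith [cDtmin_window_ge]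
  refine spLeg_allScales_of_pointDefects_V17F2_rates_of_stepZero (G := G) (P := P) (a := fun m => d * (4 : ℝ) ^ m)
    (b := fun _ => Zs * U ^ 2 + 4 / 3 * R.Gfr 1 * U ^ 2) (d := fun n => (∑ m ∈ range n, d * (4 : ℝ) ^ m) + Dd n + Df n)
    hR hc hcle hU hUle hβmin hβc hμ h0 hN (fun n hn => ?_) (fun Mq L₁ L₂ M₂ _ _ _ hLL₁ hdvd hM₁ hMq₁ hM₂ hMq₂ θ => ?_)
    (fun n h1 hn => by have := hZs0; have := hR 1; positivity) ?_ ?_ (fun n h1 hn => ?_)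
  · -- closure to the public ceiling
    calc d * (4 : ℝ) ^ n ≤ Q.CL β 0 / 4 * (4 : ℝ) ^ n := mul_le_mul_of_nonneg_right hdCL (by positivity)
      _ = Q.CL β 0 * (4 : ℝ) ^ n / 4 := by ring
      _ ≤ Q.CL β n / 4 := div_le_div_of_nonneg_right (hCL n hn) (by norm_num)
  · -- the scale-0 step: `a 0 = d`
    simpa only [pow_zero, mul_one] using hstep0 Mq L₁ L₂ M₂ hLL₁ hdvd hM₁ hMq₁ hM₂ hMq₂ θ
  · -- (R) from the GRID atom of the coarse volume, `1 ≤ n`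
    intro n h1 hn Mq L₁ L₂ M₂ _ _ _ hLL₁ hdvd hM₁ hMq₁ hM₂ hMq₂ hh₁ hh₂ hrates hframe q _
    have hK₁ := frameOK_klFlowFrameU_of_histV17F2 (L' := L₁) (M' := M₂) hR h0 (hn.trans hN) hh₁
    have hdeg₁ : (klFlowFrameU L₁ M₂ β U μ n).degree ≤ L₁ / 2 :=
      (frameOKDeg_klFlowFrameU hK₁ (hn.trans hN)).degree_le_half rfl hβmin (hL.trans hLL₁)
    have hsep := (twoLeg_slopeSizes_of_twoLegGridMomentsAt (L := L₁) (M := M₂) hβ0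
      (hGs n h1 hn Mq L₁ L₂ M₂ hLL₁ hdvd hM₁ hMq₁ hM₂ hMq₂ hh₁ hh₂ hrates hframe)).2 q
    refine (norm_fderiv_evalM_symInterp_le_of_sep_at (L := L₁) (M := M₂) hdeg₁ β U μ n q hsep).trans ?_
    linarith [norm_iteratedFDeriv_one_frameShift_le_of_frameOK hR hK₁ q]
  · -- (D) from the dual defect data, `1 ≤ n`
    intro n h1 hn Mq L₁ L₂ M₂ _ _ _ hLL₁ hdvd hM₁ hMq₁ hM₂ hMq₂ hh₁ hh₂ hrates hframe θ
    obtain ⟨b', hb'⟩ := hdvd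
    have hL' : L₂ = b' * L₁ := by rw [hb', mul_comm]
    have hLL₂ : L ≤ L₂ := hLL₁.trans (Nat.le_of_dvd (Nat.pos_of_ne_zero (NeZero.ne L₂)) ⟨b', hb'⟩)
    have hL₁0 : (0 : ℝ) < L₁ := by exact_mod_cast Nat.pos_of_ne_zero (NeZero.ne L₁)
    have hε : 0 < imagTimeWeight β M₂ := by
      unfold imagTimeWeight
      have : (0 : ℝ) < M₂ := by exact_mod_cast Nat.pos_of_ne_zero (NeZero.ne M₂)
      positivity
    have hK₁ := frameOK_klFlowFrameU_of_histV17F2 (L' := L₁) (M' := M₂) hR h0 (hn.trans hN) hh₁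
    have hK₂ := frameOK_klFlowFrameU_of_histV17F2 (L' := L₂) (M' := M₂) hR h0 (hn.trans hN) hh₂
    have hdeg₁ : (klFlowFrameU L₁ M₂ β U μ n).degree ≤ L₁ / 2 :=
      (frameOKDeg_klFlowFrameU hK₁ (hn.trans hN)).degree_le_half rfl hβmin (hL.trans hLL₁)
    have hdeg₂ : (klFlowFrameU L₂ M₂ β U μ n).degree ≤ L₂ / 2 :=
      (frameOKDeg_klFlowFrameU hK₂ (hn.trans hN)).degree_le_half rfl hβmin (hL.trans hLL₂)
    obtain ⟨oc, of, hdef, hfar⟩ := hdual n h1 hn Mq L₁ L₂ M₂ hLL₁ ⟨b', hb'⟩ hM₁ hMq₁ hM₂ hMq₂ hh₁ hh₂ hrates hframe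
    have hdef' := fun m hm σ => (le_div_iff₀' hε).2 (hdef m hm σ)
    have hfar' := fun m hm σ => (le_div_iff₀' hε).2 (hfar m hm σ)
    have hD := abs_symInterp_locRe_sub_le_frame_add_dualDefect' (M := M₂) hL' hβ0 U μ hdeg₁ hdeg₂ n oc of hdef' hfar'
      (klFermiPoint μ (klFlowFrameU L₂ M₂ β U μ n) θ)
    refine hD.trans ?_
    have hKq := hframe (klFermiPoint μ (klFlowFrameU L₂ M₂ β U μ n) θ)
    have hεsimp : imagTimeWeight β M₂ * (Dd n / L₁ / imagTimeWeight β M₂ + Df n / L₁ / imagTimeWeight β M₂) = (Dd n + Df n) / L₁ := by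
      field_simp
    rw [hεsimp]
    have hsum : (∑ m ∈ range n, d * (4 : ℝ) ^ m) / L₁ + (Dd n + Df n) / L₁ = ((∑ m ∈ range n, d * (4 : ℝ) ^ m) + Dd n + Df n) / L₁ := by
      field_simp
      ring
    linarith [hsum]
  · -- the budget on the rates `d·4^m`
    show (Zs * U ^ 2 + 4 / 3 * R.Gfr 1 * U ^ 2) * (∑ m ∈ range n, d * (4 : ℝ) ^ m) / klCurveD +
        ((∑ m ∈ range n, d * (4 : ℝ) ^ m) + Dd n + Df n) ≤ d * (4 : ℝ) ^ n
    rw [sum_range_mul_four_pow]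
    have hF0 : 0 ≤ d * ((4 : ℝ) ^ n - 1) / 3 := by
      have : (1 : ℝ) ≤ (4 : ℝ) ^ n := one_le_pow₀ (by norm_num)
      have : 0 ≤ d * ((4 : ℝ) ^ n - 1) := mul_nonneg hd (by linarith)
      linarith
    have h1' : (Zs * U ^ 2 + 4 / 3 * R.Gfr 1 * U ^ 2) * (d * ((4 : ℝ) ^ n - 1) / 3) / klCurveD ≤ d * ((4 : ℝ) ^ n - 1) / 3 := by
      rw [div_le_iff₀ hDpos]
      calc (Zs * U ^ 2 + 4 / 3 * R.Gfr 1 * U ^ 2) * (d * ((4 : ℝ) ^ n - 1) / 3)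
          ≤ klCurveD * (d * ((4 : ℝ) ^ n - 1) / 3) := mul_le_mul_of_nonneg_right hsmall hF0
        _ = d * ((4 : ℝ) ^ n - 1) / 3 * klCurveD := by ring
    have h2 := hDsum n h1 hn
    have h3 : d * ((4 : ℝ) ^ n - 1) / 3 + (d * ((4 : ℝ) ^ n - 1) / 3 + Dd n + Df n) ≤ d * (4 : ℝ) ^ n := by nlinarith
    linarith


end V17F2

end Summit.HubbardSuperconductivity.HubbardSuperconductivity.Theorems.EngineV8

end
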